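import Mathlib
import Summits.NavierStokesRegularity.NavierStokesRegularity.Theorems.SubOnsagerCeilingSideBranchCaptureLaw
import Summits.NavierStokesRegularity.NavierStokesRegularity.Theorems.SubOnsagerCeilingSideBranchChainDrive
import HarnessLib

/-!
# Route SubOnsagerCeiling — capture at a shell of `α_SB`, FRONT/WAKE form: the unchoked law and the windowed
# capture family (true dynamics, no sign condition, no ceiling)
# (helper file for item stmt-NavierStokesRegularity-25507 `OrthantTailCeiling`; `--supports`; def-free)

Companion of the capture law (p826926, `(s_k²+z_{k+1}²)^{3/2} ≤ 4e^{ν_{k+1}t}(Λ_k/5)∫₀ᵗx_k⁴`), toward the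
FOURTH-MOMENT OCCUPATION / PARKING bound that is the remaining debt of the refutation of the aside cruxes
`OrthantTailCeiling` (stmt-25507) / `ForwardTailCeiling` (stmt-26608).  The capture law is tight in the choked
WAKE regime but lossy on the brief, intense FRONT (there the side mode is unchoked and the capture is
`≈ ((Λ_k/5)∫_{front} x_k²)²`, quadratic in the pump coefficient).  Two lemmas let a later assembly split the
window at the end `t₁` of the front passage:

* `sideBranch_capture_unchoked` — for every `t ∈ [0,s]`:
  `√(s_k(t)² + z_{k+1}(t)²) ≤ √(s_k(0)² + z_{k+1}(0)²) + (Λ_k/5)∫₀ᵗ x_k²`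
  (`d/dt(s²+z²) ≤ 2(Λ_k/5)x_k²·|s_k| ≤ 2(Λ_k/5)x_k²√(s²+z²)`);
* `sideBranch_capture_family_window` — for `0 ≤ t₁ ≤ t ≤ s` and every `ε > 0`:
  `s_k(t)² + z_{k+1}(t)² ≤ s_k(t₁)² + z_{k+1}(t₁)² + (1/ε)(Λ_k/5)∫_{t₁}^t x_k⁴ + ε(Λ_k/5)∫_{t₁}^t s_k²`;
* `sideBranch_capture_window` — with the pocket empty at time `0`, the last term is `≤ ε·e^{ν_{k+1}t}·√(s_k(t)²+z_{k+1}(t)²)`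
  (pocket meter p619653 on `[0,t] ⊇ [t₁,t]`), so
  `Y(t) ≤ Y(t₁) + (1/ε)(Λ_k/5)∫_{t₁}^t x_k⁴ + ε e^{ν_{k+1}t}√Y(t)`: FRONT capture `Y(t₁)` (unchoked law) plus
  WAKE capture (choked law on `[t₁,t]`).

HONEST FRAMING: elementary real analysis of a Tao-type MODEL lattice ODE (route SubOnsagerCeiling, rung
TL-M2Break); bricks toward a construction that is NOT carried out here; nothing bears on Navier–Stokes
regularity; no crux is settled here. [cite: Tao2016AveragedNS, §4 (4.2)–(4.3)];
Katz–Pavlović couplings: [cite: BarbatoMorandinRomito2011, §2].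
-/

noncomputable section

-- the sub-problem namespace `NavierStokesRegularity.NavierStokesRegularity` is the tree's layout (D-0017)
set_option linter.dupNamespace false

namespace Summit.NavierStokesRegularity.NavierStokesRegularity.Theorems.SubOnsagerCeiling

open Set MeasureTheory intervalIntegral
open Literature.Analysis.FluidPDE.TaoCascade

section Solution

variable {ε₀ ν s : ℝ} {X : Fin 4 → ℤ → ℝ → ℝ}

/-- **The unchoked capture law.** Along a regular solution of the `ν`-viscous `α_SB` lattice on `[0,s]`
(`ν ≥ 0`, continuous modes; no sign condition), for every shell `k` and `t ∈ [0,s]`: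
`√(s_k(t)² + z_{k+1}(t)²) ≤ √(s_k(0)² + z_{k+1}(0)²) + (Λ_k/5)∫₀ᵗ x_k²`. [this file] -/
theorem sideBranch_capture_unchoked (hε : 0 < ε₀) (hν : 0 ≤ ν)
    (hcont : ∀ (i : Fin 4) (k : ℤ), Continuous (X i k))
    (hder : ∀ (i : Fin 4) (k : ℤ), ∀ t ∈ Icc (0 : ℝ) s, HasDerivWithinAt (X i k)
      (quadTerm ε₀ sideBranchTable X i k t - ν * (1 + ε₀) ^ ((2 : ℝ) * k) * X i k t)
      (Icc (0 : ℝ) s) t)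
    (k : ℤ) {t : ℝ} (ht : t ∈ Icc (0 : ℝ) s) :
    Real.sqrt (X 1 k t ^ 2 + X 2 (k + 1) t ^ 2) ≤ Real.sqrt (X 1 k 0 ^ 2 + X 2 (k + 1) 0 ^ 2) +
      (1 / 5 : ℝ) * (1 + ε₀) ^ ((5 : ℝ) * k / 2) * ∫ u in (0 : ℝ)..t, X 0 k u ^ 2 := by
  have hb : (0 : ℝ) < 1 + ε₀ := by linarith
  set L : ℝ := (1 / 5 : ℝ) * (1 + ε₀) ^ ((5 : ℝ) * k / 2) with hL
  set c₀ : ℝ := ν * (1 + ε₀) ^ ((2 : ℝ) * k) with hc₀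
  set c₁ : ℝ := ν * (1 + ε₀) ^ ((2 : ℝ) * ((k + 1 : ℤ) : ℝ)) with hc₁
  have hL0 : 0 ≤ L := mul_nonneg (by norm_num) (Real.rpow_nonneg hb.le _)
  have hc₀0 : 0 ≤ c₀ := mul_nonneg hν (Real.rpow_nonneg hb.le _)
  have hc₁0 : 0 ≤ c₁ := mul_nonneg hν (Real.rpow_nonneg hb.le _)
  have hsd : ∀ u ∈ Icc (0 : ℝ) s, HasDerivWithinAt (X 1 k)
      (L * X 0 k u ^ 2 - L * (X 1 k u * X 2 (k + 1) u) - c₀ * X 1 k u) (Icc 0 s) u := by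
    intro u hu
    have h := hder 1 k u hu
    rw [sideBranch_quadTerm_one] at h
    exact h
  have hzd : ∀ u ∈ Icc (0 : ℝ) s, HasDerivWithinAt (X 2 (k + 1))
      (L * X 1 k u ^ 2 - c₁ * X 2 (k + 1) u) (Icc 0 s) u := by
    intro u hu
    have h := hder 2 (k + 1) u hu
    rw [sideBranch_quadTerm_two_succ] at h
    exact h
  have h2 : Continuous fun u => X 0 k u ^ 2 := (hcont 0 k).pow 2
  -- for every `δ > 0`: `√(Y + δ) − L∫x²` is non-increasing
  have hmain : ∀ δ : ℝ, 0 < δ → Real.sqrt (X 1 k t ^ 2 + X 2 (k + 1) t ^ 2 + δ) ≤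
      Real.sqrt (X 1 k 0 ^ 2 + X 2 (k + 1) 0 ^ 2 + δ) + L * ∫ u in (0 : ℝ)..t, X 0 k u ^ 2 := by
    intro δ hδ
    set Φ : ℝ → ℝ := fun u => Real.sqrt (X 1 k u ^ 2 + X 2 (k + 1) u ^ 2 + δ) -
      L * ∫ x in (0 : ℝ)..u, X 0 k x ^ 2 with hΦ
    have hderΦ : ∀ u ∈ Icc (0 : ℝ) s, HasDerivWithinAt Φ
        ((2 * X 1 k u * (L * X 0 k u ^ 2 - L * (X 1 k u * X 2 (k + 1) u) - c₀ * X 1 k u) +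
          2 * X 2 (k + 1) u * (L * X 1 k u ^ 2 - c₁ * X 2 (k + 1) u)) /
          (2 * Real.sqrt (X 1 k u ^ 2 + X 2 (k + 1) u ^ 2 + δ)) - L * X 0 k u ^ 2) (Icc 0 s) u := by
      intro u hu
      have hA := ((h2.integral_hasStrictDerivAt 0 u).hasDerivAt).hasDerivWithinAt (s := Icc (0 : ℝ) s)
      have hY : HasDerivWithinAt (fun u => X 1 k u ^ 2 + X 2 (k + 1) u ^ 2 + δ)
          (2 * X 1 k u * (L * X 0 k u ^ 2 - L * (X 1 k u * X 2 (k + 1) u) - c₀ * X 1 k u) +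
            2 * X 2 (k + 1) u * (L * X 1 k u ^ 2 - c₁ * X 2 (k + 1) u)) (Icc 0 s) u := by
        have h := (((hsd u hu).pow 2).add ((hzd u hu).pow 2)).add_const δ
        refine h.congr_deriv ?_
        simp only [Nat.cast_ofNat]
        ring
      have hpos : X 1 k u ^ 2 + X 2 (k + 1) u ^ 2 + δ ≠ 0 := by positivity
      have hS := hY.sqrt hpos
      exact hS.sub (hA.const_mul L)
    have hle : ∀ u ∈ Icc (0 : ℝ) s,
        (2 * X 1 k u * (L * X 0 k u ^ 2 - L * (X 1 k u * X 2 (k + 1) u) - c₀ * X 1 k u) +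
          2 * X 2 (k + 1) u * (L * X 1 k u ^ 2 - c₁ * X 2 (k + 1) u)) /
          (2 * Real.sqrt (X 1 k u ^ 2 + X 2 (k + 1) u ^ 2 + δ)) - L * X 0 k u ^ 2 ≤ 0 := by
      intro u hu
      set R : ℝ := Real.sqrt (X 1 k u ^ 2 + X 2 (k + 1) u ^ 2 + δ) with hR
      have hRpos : 0 < R := Real.sqrt_pos.2 (by positivity)
      have hSR : X 1 k u ≤ R := by
        calc X 1 k u ≤ |X 1 k u| := le_abs_self _
          _ = Real.sqrt (X 1 k u ^ 2) := (Real.sqrt_sq_eq_abs _).symm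
          _ ≤ R := Real.sqrt_le_sqrt (by nlinarith [sq_nonneg (X 2 (k + 1) u)])
      -- numerator ≤ 2 L x² R
      have hnum : 2 * X 1 k u * (L * X 0 k u ^ 2 - L * (X 1 k u * X 2 (k + 1) u) - c₀ * X 1 k u) +
          2 * X 2 (k + 1) u * (L * X 1 k u ^ 2 - c₁ * X 2 (k + 1) u) ≤ 2 * L * X 0 k u ^ 2 * R := by
        have hid : 2 * X 1 k u * (L * X 0 k u ^ 2 - L * (X 1 k u * X 2 (k + 1) u) - c₀ * X 1 k u) +
            2 * X 2 (k + 1) u * (L * X 1 k u ^ 2 - c₁ * X 2 (k + 1) u) =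
            2 * L * X 0 k u ^ 2 * X 1 k u - 2 * (c₀ * X 1 k u ^ 2) - 2 * (c₁ * X 2 (k + 1) u ^ 2) := by
          ring
        rw [hid]
        have h1 : 0 ≤ c₀ * X 1 k u ^ 2 := by positivity
        have h3 : 0 ≤ c₁ * X 2 (k + 1) u ^ 2 := by positivity
        have h4 : 2 * L * X 0 k u ^ 2 * X 1 k u ≤ 2 * L * X 0 k u ^ 2 * R :=
          mul_le_mul_of_nonneg_left hSR (by positivity)
        linarith
      have h5 : (2 * X 1 k u * (L * X 0 k u ^ 2 - L * (X 1 k u * X 2 (k + 1) u) - c₀ * X 1 k u) +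
          2 * X 2 (k + 1) u * (L * X 1 k u ^ 2 - c₁ * X 2 (k + 1) u)) / (2 * R) ≤
          (2 * L * X 0 k u ^ 2 * R) / (2 * R) := div_le_div_of_nonneg_right hnum (by positivity)
      have h6 : (2 * L * X 0 k u ^ 2 * R) / (2 * R) = L * X 0 k u ^ 2 := by
        field_simp
      linarith
    have h := sideBranch_le_init_of_deriv_nonpos hderΦ hle ht
    simp only [hΦ, integral_same, mul_zero, sub_zero] at h
    linarith
  -- let `δ → 0`
  have hY0 : 0 ≤ X 1 k t ^ 2 + X 2 (k + 1) t ^ 2 := by positivity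
  have hY00 : 0 ≤ X 1 k 0 ^ 2 + X 2 (k + 1) 0 ^ 2 := by positivity
  refine le_of_forall_pos_le_add fun η hη => ?_
  -- choose `δ = η²`: `√(Y₀ + η²) ≤ √Y₀ + η`
  have hδ : 0 < η ^ 2 := by positivity
  have h1 := hmain (η ^ 2) hδ
  have h3 : Real.sqrt (X 1 k 0 ^ 2 + X 2 (k + 1) 0 ^ 2 + η ^ 2) ≤
      Real.sqrt (X 1 k 0 ^ 2 + X 2 (k + 1) 0 ^ 2) + η := by
    rw [Real.sqrt_le_left (by positivity)]
    have hs0 := Real.sq_sqrt hY00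
    have hsn := Real.sqrt_nonneg (X 1 k 0 ^ 2 + X 2 (k + 1) 0 ^ 2)
    nlinarith
  have h4 : Real.sqrt (X 1 k t ^ 2 + X 2 (k + 1) t ^ 2) ≤
      Real.sqrt (X 1 k t ^ 2 + X 2 (k + 1) t ^ 2 + η ^ 2) := Real.sqrt_le_sqrt (by linarith)
  linarith

/-- **The windowed capture family.** Along a regular solution of the `ν`-viscous `α_SB` lattice on `[0,s]`
(`ν ≥ 0`, continuous modes; no sign condition), for `0 ≤ t₁ ≤ t ≤ s` and every `ε > 0`:
`s_k(t)² + z_{k+1}(t)² ≤ s_k(t₁)² + z_{k+1}(t₁)² + (1/ε)(Λ_k/5)∫_{t₁}^t x_k⁴ + ε(Λ_k/5)∫_{t₁}^t s_k²`.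
[this file] -/
theorem sideBranch_capture_family_window (hε : 0 < ε₀) (hν : 0 ≤ ν)
    (hcont : ∀ (i : Fin 4) (k : ℤ), Continuous (X i k))
    (hder : ∀ (i : Fin 4) (k : ℤ), ∀ t ∈ Icc (0 : ℝ) s, HasDerivWithinAt (X i k)
      (quadTerm ε₀ sideBranchTable X i k t - ν * (1 + ε₀) ^ ((2 : ℝ) * k) * X i k t)
      (Icc (0 : ℝ) s) t)
    (k : ℤ) {ε t₁ t : ℝ} (hεp : 0 < ε) (ht₁ : 0 ≤ t₁) (ht₁t : t₁ ≤ t) (hts : t ≤ s) :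
    X 1 k t ^ 2 + X 2 (k + 1) t ^ 2 ≤ X 1 k t₁ ^ 2 + X 2 (k + 1) t₁ ^ 2 +
      (1 / ε) * ((1 / 5 : ℝ) * (1 + ε₀) ^ ((5 : ℝ) * k / 2) * ∫ u in t₁..t, X 0 k u ^ 4) +
      ε * ((1 / 5 : ℝ) * (1 + ε₀) ^ ((5 : ℝ) * k / 2) * ∫ u in t₁..t, X 1 k u ^ 2) := by
  have hb : (0 : ℝ) < 1 + ε₀ := by linarith
  set L : ℝ := (1 / 5 : ℝ) * (1 + ε₀) ^ ((5 : ℝ) * k / 2) with hL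
  set c₀ : ℝ := ν * (1 + ε₀) ^ ((2 : ℝ) * k) with hc₀
  set c₁ : ℝ := ν * (1 + ε₀) ^ ((2 : ℝ) * ((k + 1 : ℤ) : ℝ)) with hc₁
  have hL0 : 0 ≤ L := mul_nonneg (by norm_num) (Real.rpow_nonneg hb.le _)
  have hc₀0 : 0 ≤ c₀ := mul_nonneg hν (Real.rpow_nonneg hb.le _)
  have hc₁0 : 0 ≤ c₁ := mul_nonneg hν (Real.rpow_nonneg hb.le _)
  have hsub : Icc t₁ t ⊆ Icc (0 : ℝ) s := Icc_subset_Icc ht₁ hts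
  have hsd : ∀ u ∈ Icc t₁ t, HasDerivWithinAt (X 1 k)
      (L * X 0 k u ^ 2 - L * (X 1 k u * X 2 (k + 1) u) - c₀ * X 1 k u) (Icc t₁ t) u := by
    intro u hu
    have h := (hder 1 k u (hsub hu)).mono hsub
    rw [sideBranch_quadTerm_one] at h
    exact h
  have hzd : ∀ u ∈ Icc t₁ t, HasDerivWithinAt (X 2 (k + 1))
      (L * X 1 k u ^ 2 - c₁ * X 2 (k + 1) u) (Icc t₁ t) u := by
    intro u hu
    have h := (hder 2 (k + 1) u (hsub hu)).mono hsub
    rw [sideBranch_quadTerm_two_succ] at h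
    exact h
  have h4 : Continuous fun u => X 0 k u ^ 4 := (hcont 0 k).pow 4
  have h2 : Continuous fun u => X 1 k u ^ 2 := (hcont 1 k).pow 2
  -- `Ψ = −(Y − (1/ε)L∫_{t₁} x⁴ − εL∫_{t₁} s²)` is non-decreasing on `[t₁, t]`
  set Ψ : ℝ → ℝ := fun u => -(X 1 k u ^ 2 + X 2 (k + 1) u ^ 2 -
    (1 / ε) * (L * ∫ x in t₁..u, X 0 k x ^ 4) - ε * (L * ∫ x in t₁..u, X 1 k x ^ 2)) with hΨ
  have hderΨ : ∀ u ∈ Icc t₁ t, HasDerivWithinAt Ψ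
      (-(2 * X 1 k u * (L * X 0 k u ^ 2 - L * (X 1 k u * X 2 (k + 1) u) - c₀ * X 1 k u) +
        2 * X 2 (k + 1) u * (L * X 1 k u ^ 2 - c₁ * X 2 (k + 1) u) -
        (1 / ε) * (L * X 0 k u ^ 4) - ε * (L * X 1 k u ^ 2))) (Icc t₁ t) u := by
    intro u hu
    have hA := ((h4.integral_hasStrictDerivAt t₁ u).hasDerivAt).hasDerivWithinAt (s := Icc t₁ t)
    have hB := ((h2.integral_hasStrictDerivAt t₁ u).hasDerivAt).hasDerivWithinAt (s := Icc t₁ t)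
    have hS := (hsd u hu).pow 2
    have hZ := (hzd u hu).pow 2
    have h := (((hS.add hZ).sub ((hA.const_mul L).const_mul (1 / ε))).sub
      ((hB.const_mul L).const_mul ε)).neg
    refine h.congr_deriv ?_
    simp only [Nat.cast_ofNat]
    ring
  have hnn : ∀ u ∈ Icc t₁ t,
      0 ≤ -(2 * X 1 k u * (L * X 0 k u ^ 2 - L * (X 1 k u * X 2 (k + 1) u) - c₀ * X 1 k u) +
        2 * X 2 (k + 1) u * (L * X 1 k u ^ 2 - c₁ * X 2 (k + 1) u) -
        (1 / ε) * (L * X 0 k u ^ 4) - ε * (L * X 1 k u ^ 2)) := by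
    intro u hu
    have hyoung : 2 * X 0 k u ^ 2 * X 1 k u ≤ (1 / ε) * X 0 k u ^ 4 + ε * X 1 k u ^ 2 := by
      have hid : (1 / ε) * X 0 k u ^ 4 + ε * X 1 k u ^ 2 - 2 * X 0 k u ^ 2 * X 1 k u =
          (1 / ε) * (X 0 k u ^ 2 - ε * X 1 k u) ^ 2 := by
        field_simp
        ring
      have : 0 ≤ (1 / ε) * (X 0 k u ^ 2 - ε * X 1 k u) ^ 2 := by positivity
      linarith
    have h1 : 0 ≤ c₀ * X 1 k u ^ 2 := by positivity
    have h3 : 0 ≤ c₁ * X 2 (k + 1) u ^ 2 := by positivity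
    have hid2 : 2 * X 1 k u * (L * X 0 k u ^ 2 - L * (X 1 k u * X 2 (k + 1) u) - c₀ * X 1 k u) +
        2 * X 2 (k + 1) u * (L * X 1 k u ^ 2 - c₁ * X 2 (k + 1) u) -
        (1 / ε) * (L * X 0 k u ^ 4) - ε * (L * X 1 k u ^ 2) =
        L * (2 * X 0 k u ^ 2 * X 1 k u - ((1 / ε) * X 0 k u ^ 4 + ε * X 1 k u ^ 2)) -
          2 * (c₀ * X 1 k u ^ 2) - 2 * (c₁ * X 2 (k + 1) u ^ 2) := by ring
    rw [hid2]
    have h5 : L * (2 * X 0 k u ^ 2 * X 1 k u - ((1 / ε) * X 0 k u ^ 4 + ε * X 1 k u ^ 2)) ≤ 0 :=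
      mul_nonpos_of_nonneg_of_nonpos hL0 (by linarith)
    linarith
  have h := sideBranch_le_of_deriv_nonneg hderΨ hnn (right_mem_Icc.2 ht₁t)
  simp only [hΨ, integral_same, mul_zero, sub_zero] at h
  linarith

/-- **The windowed capture law (FRONT + WAKE).** If moreover the pocket is empty at time `0`,
`z_{k+1}(0) = 0`, then for `0 ≤ t₁ ≤ t ≤ s` and every `ε > 0`, with `Y(u) = s_k(u)² + z_{k+1}(u)²`:
`Y(t) ≤ Y(t₁) + (1/ε)(Λ_k/5)∫_{t₁}^t x_k⁴ + ε·e^{ν_{k+1}t}·√Y(t)`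
(the pocket meter on `[0,t]` dominates `(Λ_k/5)∫_{t₁}^t s_k²`).  Use: `Y(t₁)` from the unchoked law on the
front window `[0,t₁]`, the rest from the choked law on the wake window `[t₁,t]`. [this file] -/
theorem sideBranch_capture_window (hε : 0 < ε₀) (hν : 0 ≤ ν)
    (hcont : ∀ (i : Fin 4) (k : ℤ), Continuous (X i k))
    (hder : ∀ (i : Fin 4) (k : ℤ), ∀ t ∈ Icc (0 : ℝ) s, HasDerivWithinAt (X i k)
      (quadTerm ε₀ sideBranchTable X i k t - ν * (1 + ε₀) ^ ((2 : ℝ) * k) * X i k t)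
      (Icc (0 : ℝ) s) t)
    (k : ℤ) (hz0 : X 2 (k + 1) 0 = 0) {ε t₁ t : ℝ} (hεp : 0 < ε) (ht₁ : 0 ≤ t₁) (ht₁t : t₁ ≤ t)
    (hts : t ≤ s) :
    X 1 k t ^ 2 + X 2 (k + 1) t ^ 2 ≤ X 1 k t₁ ^ 2 + X 2 (k + 1) t₁ ^ 2 +
      (1 / ε) * ((1 / 5 : ℝ) * (1 + ε₀) ^ ((5 : ℝ) * k / 2) * ∫ u in t₁..t, X 0 k u ^ 4) +
      ε * (Real.exp (ν * (1 + ε₀) ^ ((2 : ℝ) * ((k + 1 : ℤ) : ℝ)) * t) *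
        Real.sqrt (X 1 k t ^ 2 + X 2 (k + 1) t ^ 2)) := by
  have hb : (0 : ℝ) < 1 + ε₀ := by linarith
  have ht : t ∈ Icc (0 : ℝ) s := ⟨ht₁.trans ht₁t, hts⟩
  have h1 := sideBranch_capture_family_window hε hν hcont hder k hεp ht₁ ht₁t hts
  have hmeter := sideBranch_pocket_meter hε hν hcont hder k hz0 ht
  have hE : 0 < Real.exp (ν * (1 + ε₀) ^ ((2 : ℝ) * ((k + 1 : ℤ) : ℝ)) * t) := Real.exp_pos _
  have hL0 : 0 ≤ (1 / 5 : ℝ) * (1 + ε₀) ^ ((5 : ℝ) * k / 2) :=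
    mul_nonneg (by norm_num) (Real.rpow_nonneg hb.le _)
  -- `∫_{t₁}^t s² ≤ ∫_0^t s²`
  have h2c : Continuous fun u => X 1 k u ^ 2 := (hcont 1 k).pow 2
  have hsplit : (∫ u in (0 : ℝ)..t, X 1 k u ^ 2) =
      (∫ u in (0 : ℝ)..t₁, X 1 k u ^ 2) + ∫ u in t₁..t, X 1 k u ^ 2 :=
    (intervalIntegral.integral_add_adjacent_intervals (h2c.intervalIntegrable 0 t₁)
      (h2c.intervalIntegrable t₁ t)).symm
  have hfront : 0 ≤ ∫ u in (0 : ℝ)..t₁, X 1 k u ^ 2 :=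
    intervalIntegral.integral_nonneg ht₁ fun u _ => by positivity
  have hwin : (∫ u in t₁..t, X 1 k u ^ 2) ≤ ∫ u in (0 : ℝ)..t, X 1 k u ^ 2 := by
    rw [hsplit]; linarith
  have hzle : X 2 (k + 1) t ≤ Real.sqrt (X 1 k t ^ 2 + X 2 (k + 1) t ^ 2) := by
    calc X 2 (k + 1) t ≤ |X 2 (k + 1) t| := le_abs_self _
      _ = Real.sqrt (X 2 (k + 1) t ^ 2) := (Real.sqrt_sq_eq_abs _).symm
      _ ≤ Real.sqrt (X 1 k t ^ 2 + X 2 (k + 1) t ^ 2) :=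
          Real.sqrt_le_sqrt (by nlinarith [sq_nonneg (X 1 k t)])
  have h3 : (1 / 5 : ℝ) * (1 + ε₀) ^ ((5 : ℝ) * k / 2) * (∫ u in t₁..t, X 1 k u ^ 2) ≤
      Real.exp (ν * (1 + ε₀) ^ ((2 : ℝ) * ((k + 1 : ℤ) : ℝ)) * t) *
        Real.sqrt (X 1 k t ^ 2 + X 2 (k + 1) t ^ 2) :=
    calc (1 / 5 : ℝ) * (1 + ε₀) ^ ((5 : ℝ) * k / 2) * (∫ u in t₁..t, X 1 k u ^ 2)
        ≤ (1 / 5 : ℝ) * (1 + ε₀) ^ ((5 : ℝ) * k / 2) * (∫ u in (0 : ℝ)..t, X 1 k u ^ 2) :=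
          mul_le_mul_of_nonneg_left hwin hL0
      _ ≤ Real.exp (ν * (1 + ε₀) ^ ((2 : ℝ) * ((k + 1 : ℤ) : ℝ)) * t) * X 2 (k + 1) t := hmeter
      _ ≤ Real.exp (ν * (1 + ε₀) ^ ((2 : ℝ) * ((k + 1 : ℤ) : ℝ)) * t) *
          Real.sqrt (X 1 k t ^ 2 + X 2 (k + 1) t ^ 2) := mul_le_mul_of_nonneg_left hzle hE.le
  have h4 := mul_le_mul_of_nonneg_left h3 hεp.le
  linarith [h1, h4]

end Solution

end Summit.NavierStokesRegularity.NavierStokesRegularity.Theorems.SubOnsagerCeiling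

end
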